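import Literature.AnabelianGeometry.SemiGraphs.TemperedCompactVerticialOrCommutative
import Literature.AnabelianGeometry.SemiGraphs.TemperedThm37OfTopCyclic
import Literature.AnabelianGeometry.SemiGraphs.TemperedEdgeLikeIsInfVerticialHolds
import Literature.AnabelianGeometry.SemiGraphs.TemperedVerticialDistinctSameVertex
import HarnessLib

/-!
# ANCHORED [SemiAnbd] Thm 3.7 (iii)/(iv) at EVERY countable graph with TOPOLOGICALLY CYCLIC edge groups —
# cores allowed (proof-only)

Mochizuki, *Semi-graphs of anabelioids*, Publ. RIMS **42** (2006), §3, Theorem 3.7 (iii) pp. 40–41, (iv) p. 41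
[cite: MochizukiSemiAnbd2006, Thm 3.7(iii) pp.40-41].  Dual semi-graphs of pointed stable curves have PROCYCLIC
edge groups `Ẑ(1)^{(Σ)}`; so do the cell's countermodels `𝒢_θ(p, n)` and `𝒢⋆(p)` (`ℤ_p`).

PROOF-ONLY file (abc-iut cell, layer L3, row «ANCHORED@STAR» sequel, seat abc-iut-w6-d064 gen 7; no definition, no
named fact).  This seat's dichotomy `le_verticial_or_commutative_of_commEdges` («compact ⇒ verticial-contained or
commutative», `TemperedCompactVerticialOrCommutative.lean`, any countable `𝔾`) combined with abc-iut-f-172's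
host-free compact-centraliser theorem on the TOP-CYCLIC class (`centralizer_le_verticial_of_compact_of_topCyclic`,
`TemperedHbddOfTopCyclic.lean` — ANY underlying graph, infinitely-branching cores included) gives the anchored package
with NO hypothesis on `𝔾` at all:

* `commEdges_of_topCyclic` — topologically cyclic edge groups are commutative;
* `exists_verticial_ge_of_inf_verticial_ne_bot_of_topCyclic` — **for every countable `𝒢` satisfying the hypotheses
  of Thm 3.7 whose edge groups are topologically cyclic, every chart, every compact `K ≤ π₁^temp(𝒢)` with
  `K ⊓ H₀ ≠ 1` for some verticial `H₀` lies in a verticial subgroup** (a commutative anchored `K` satisfies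
  `K ≤ C(K ⊓ H₀) ≤ H₀`);
* the (iv) package on the same class, abc-iut-w6-d062's arguments verbatim
  (`TemperedMaximalCompactAnchoredOfLocallyFinite.lean`) with abc-iut-f-172's `compactInTwoVerticial_of_topCyclic`:
  `isMaximalCompactSubgroup_of_mem_verticialSubgroups_of_topCyclic` (EVERY verticial subgroup is maximal compact),
  `isMaximalCompactSubgroup_iff_mem_verticialSubgroups_of_anchored_of_topCyclic`,
  `exists_maximalCompact_inf_eq_of_mem_edgeLikeSubgroups_of_topCyclic`,
  `exists_mem_edgeLikeSubgroups_of_maximalCompact_inf_of_anchored_of_topCyclic`, and the two dichotomies for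
  maximal compact subgroups (`… ∨ anchor-free`, `… ∨ commutative`).

So, for topologically cyclic edge groups, the cell's ∀-countable typings of Thm 3.7 (iii)–(iv) fail ONLY through
COMMUTATIVE ANCHOR-FREE compact subgroups (which exist at `𝒢_θ` and `𝒢⋆(p)`).  Nothing is asserted for those;
nothing bears on [IUTchIII] Cor. 3.12 (every print consumer has finite `𝔾`); typed ≠ proved.
-/

namespace Literature.AnabelianGeometry.SemiGraphs

namespace ProfiniteSemiGraph

open Topology

universe u

variable (𝒢 : ProfiniteSemiGraph.{u})

/-- **Topologically cyclic edge groups are commutative** (the closure of a cyclic subgroup of a Hausdorff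
topological group is commutative; `Π_e` is Hausdorff, being a totally disconnected topological group).
[cite: MochizukiSemiAnbd2006, Def 2.1 p.22] -/
theorem commEdges_of_topCyclic
    (hcyc : ∀ e : 𝒢.graph.Edge, ∃ t₀ : 𝒢.Ge e, (Subgroup.zpowers t₀).topologicalClosure = ⊤) :
    ∀ (e : 𝒢.graph.Edge) (k k' : 𝒢.Ge e), k * k' = k' * k := by
  intro e k k'
  obtain ⟨t₀, ht₀⟩ := hcyc e
  haveI : T1Space (𝒢.Ge e) := ⟨fun x => by
    rw [← totallyDisconnectedSpace_iff_connectedComponent_singleton.mp inferInstance x]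
    exact isClosed_connectedComponent⟩
  haveI : T2Space (𝒢.Ge e) := IsTopologicalGroup.t2Space_of_one_sep fun x hx =>
    ⟨{x}ᶜ, isOpen_compl_singleton.mem_nhds (by simpa using hx.symm), fun h => h rfl⟩
  have hs : ∀ u v : Subgroup.zpowers t₀, u * v = v * u := by
    rintro ⟨u, hu⟩ ⟨v, hv⟩
    obtain ⟨m, rfl⟩ := Subgroup.mem_zpowers_iff.mp hu
    obtain ⟨n, rfl⟩ := Subgroup.mem_zpowers_iff.mp hv
    exact Subtype.ext (zpow_mul_comm t₀ m n)
  letI := Subgroup.commGroupTopologicalClosure (Subgroup.zpowers t₀) hs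
  have hk : k ∈ (Subgroup.zpowers t₀).topologicalClosure := by rw [ht₀]; trivial
  have hk' : k' ∈ (Subgroup.zpowers t₀).topologicalClosure := by rw [ht₀]; trivial
  exact congrArg Subtype.val (mul_comm (⟨k, hk⟩ : (Subgroup.zpowers t₀).topologicalClosure) ⟨k', hk'⟩)

/-- **ANCHORED Thm 3.7 (iii), first sentence, at the CANONICAL chart — topologically cyclic edge groups, ANY `𝔾`**:
a compact `K` with `K ⊓ H₀ ≠ 1` for a verticial `H₀` lies in a verticial subgroup (dichotomy
`le_verticial_or_commutative_of_commEdges_canonical`; a commutative `K` satisfies `K ≤ C(K ⊓ H₀) ≤ H₀` by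
abc-iut-f-172's `centralizer_le_verticial_of_compact_of_topCyclic`). [cite: MochizukiSemiAnbd2006, Thm 3.7(iii) pp.40-41] -/
theorem exists_verticial_ge_of_inf_verticial_ne_bot_of_topCyclic_canonical (h37 : 𝒢.Thm37Hypotheses)
    (hcyc : ∀ e : 𝒢.graph.Edge, ∃ t₀ : 𝒢.Ge e, (Subgroup.zpowers t₀).topologicalClosure = ⊤)
    (K : Subgroup (𝒢.temperedPiChart h37.toProp36Hypotheses).G)
    (hKc : IsCompact (K : Set (𝒢.temperedPiChart h37.toProp36Hypotheses).G))
    {v₀ : 𝒢.graph.Vertex} {H₀ : Subgroup (𝒢.temperedPiChart h37.toProp36Hypotheses).G}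
    (hH₀ : H₀ ∈ verticialSubgroups (𝒢.temperedPiChart h37.toProp36Hypotheses) v₀) (hanch : K ⊓ H₀ ≠ ⊥) :
    ∃ (v : 𝒢.graph.Vertex) (H : Subgroup (𝒢.temperedPiChart h37.toProp36Hypotheses).G),
      H ∈ verticialSubgroups (𝒢.temperedPiChart h37.toProp36Hypotheses) v ∧ K ≤ H := by
  rcases 𝒢.le_verticial_or_commutative_of_commEdges_canonical h37.toProp36Hypotheses (𝒢.commEdges_of_topCyclic hcyc)
    K hKc with h | hcomm
  · exact h
  · haveI := (𝒢.temperedPiChart h37.toProp36Hypotheses).t2Space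
    have hCc : IsCompact ((K ⊓ H₀ : Subgroup (𝒢.temperedPiChart h37.toProp36Hypotheses).G) :
        Set (𝒢.temperedPiChart h37.toProp36Hypotheses).G) := by
      rw [Subgroup.coe_inf]
      exact hKc.inter_right (isCompact_of_mem_verticialSubgroups _ hH₀).isClosed
    refine ⟨v₀, H₀, hH₀, fun g hg => ?_⟩
    refine 𝒢.centralizer_le_verticial_of_compact_of_topCyclic h37 hcyc (K ⊓ H₀) hCc hanch hH₀ inf_le_right ?_
    rw [Subgroup.mem_centralizer_iff]
    rintro x ⟨hxK, -⟩
    exact hcomm x hxK g hg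

variable {𝒢}

/-- **ANCHORED [SemiAnbd] Thm 3.7 (iii), first sentence, for every countable `𝒢` satisfying the hypotheses of
Thm 3.7 whose EDGE GROUPS ARE TOPOLOGICALLY CYCLIC — no condition on `𝔾` (infinite valence, rays and cores
allowed), every chart**: every compact `K ≤ π₁^temp(𝒢)` meeting some verticial subgroup `H₀` non-trivially lies in
a verticial subgroup. [cite: MochizukiSemiAnbd2006, Thm 3.7(iii) pp.40-41] -/
theorem exists_verticial_ge_of_inf_verticial_ne_bot_of_topCyclic (h37 : 𝒢.Thm37Hypotheses)
    (hcyc : ∀ e : 𝒢.graph.Edge, ∃ t₀ : 𝒢.Ge e, (Subgroup.zpowers t₀).topologicalClosure = ⊤)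
    (c : TemperedPiChart 𝒢) (K : Subgroup c.G) (hKc : IsCompact (K : Set c.G))
    {v₀ : 𝒢.graph.Vertex} {H₀ : Subgroup c.G} (hH₀ : H₀ ∈ verticialSubgroups c v₀) (hanch : K ⊓ H₀ ≠ ⊥) :
    ∃ (v : 𝒢.graph.Vertex) (H : Subgroup c.G), H ∈ verticialSubgroups c v ∧ K ≤ H := by
  obtain ⟨φ, ψ, hψφ, hφψ, hφ, hψ⟩ :=
    TemperedPiChart.exists_compatIso (𝒢.temperedPiChart h37.toProp36Hypotheses) c
  have hinj : Function.Injective ψ := fun y₁ y₂ h => by rw [← hφψ y₁, ← hφψ y₂, h]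
  have hK' : IsCompact (K.map ψ.toMonoidHom : Set (𝒢.temperedPiChart h37.toProp36Hypotheses).G) := by
    rw [Subgroup.coe_map]
    exact hKc.image ψ.continuous
  have hH₀' : H₀.map ψ.toMonoidHom ∈ verticialSubgroups (𝒢.temperedPiChart h37.toProp36Hypotheses) v₀ :=
    (mem_verticialSubgroups_iff_map φ hφ ψ hφψ hψ H₀).mp hH₀
  have hanch' : K.map ψ.toMonoidHom ⊓ H₀.map ψ.toMonoidHom ≠ ⊥ := by
    rw [← Subgroup.map_inf_eq K H₀ _ hinj]
    exact fun h0 => hanch ((Subgroup.map_eq_bot_iff_of_injective _ hinj).mp h0)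
  obtain ⟨v, H', hH', hKH'⟩ :=
    𝒢.exists_verticial_ge_of_inf_verticial_ne_bot_of_topCyclic_canonical h37 hcyc (K.map ψ.toMonoidHom) hK' hH₀'
      hanch'
  refine ⟨v, H'.map φ.toMonoidHom, mem_verticialSubgroups_map φ hφ hH', fun g hg => ?_⟩
  exact ⟨ψ g, hKH' ⟨g, hg, rfl⟩, hφψ g⟩

/-- **ANCHORED maximal compact ⇒ verticial** (Thm 3.7 (iv), first clause, anchored form; topologically cyclic edge
groups, any `𝔾`, every chart). [cite: MochizukiSemiAnbd2006, Thm 3.7(iv) p.41] -/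
theorem exists_mem_verticialSubgroups_of_isMaximalCompactSubgroup_of_topCyclic (h37 : 𝒢.Thm37Hypotheses)
    (hcyc : ∀ e : 𝒢.graph.Edge, ∃ t₀ : 𝒢.Ge e, (Subgroup.zpowers t₀).topologicalClosure = ⊤)
    (c : TemperedPiChart 𝒢) (K : Subgroup c.G) (hK : IsMaximalCompactSubgroup K)
    {v₀ : 𝒢.graph.Vertex} {H₀ : Subgroup c.G} (hH₀ : H₀ ∈ verticialSubgroups c v₀) (hanch : K ⊓ H₀ ≠ ⊥) :
    ∃ v : 𝒢.graph.Vertex, K ∈ verticialSubgroups c v := by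
  obtain ⟨v, H, hH, hKH⟩ := exists_verticial_ge_of_inf_verticial_ne_bot_of_topCyclic h37 hcyc c K hK.1 hH₀ hanch
  exact ⟨v, (hK.2 H (isCompact_of_mem_verticialSubgroups c hH) hKH) ▸ hH⟩

/-- **Violators of the existence sentence are ANCHOR-FREE** (topologically cyclic edge groups, any `𝔾`, every
chart): a compact subgroup in no verticial subgroup meets every verticial subgroup trivially (and is commutative,
`commutative_of_forall_not_le_verticial_of_commEdges`). [cite: MochizukiSemiAnbd2006, Thm 3.7(iii) pp.40-41] -/
theorem inf_verticial_eq_bot_of_forall_not_le_of_topCyclic (h37 : 𝒢.Thm37Hypotheses)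
    (hcyc : ∀ e : 𝒢.graph.Edge, ∃ t₀ : 𝒢.Ge e, (Subgroup.zpowers t₀).topologicalClosure = ⊤)
    (c : TemperedPiChart 𝒢) (K : Subgroup c.G) (hKc : IsCompact (K : Set c.G))
    (hno : ∀ (v : 𝒢.graph.Vertex) (H : Subgroup c.G), H ∈ verticialSubgroups c v → ¬ K ≤ H)
    {v₀ : 𝒢.graph.Vertex} {H₀ : Subgroup c.G} (hH₀ : H₀ ∈ verticialSubgroups c v₀) : K ⊓ H₀ = ⊥ := by
  by_contra hne
  obtain ⟨v, H, hH, hKH⟩ := exists_verticial_ge_of_inf_verticial_ne_bot_of_topCyclic h37 hcyc c K hKc hH₀ hne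
  exact hno v H hH hKH

variable (𝒢)

/-- **Thm 3.7 (iv), «verticial ⇒ maximal compact» — topologically cyclic edge groups, ANY `𝔾`, every chart**: every
verticial subgroup is a maximal compact subgroup (abc-iut-w6-d062's argument: a compact over-group of `H ≠ 1` is
anchored at `H`, hence inside a verticial `H' ⊇ H`, and `H = H'` by Thm 3.7 (ii); `H = 1` forces `π₁^temp = 1`).
[cite: MochizukiSemiAnbd2006, Thm 3.7(iv) p.41] -/
theorem isMaximalCompactSubgroup_of_mem_verticialSubgroups_of_topCyclic (h37 : 𝒢.Thm37Hypotheses)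
    (hcyc : ∀ e : 𝒢.graph.Edge, ∃ t₀ : 𝒢.Ge e, (Subgroup.zpowers t₀).topologicalClosure = ⊤)
    (c : TemperedPiChart 𝒢) {v : 𝒢.graph.Vertex} {H : Subgroup c.G}
    (hH : H ∈ verticialSubgroups c v) : IsMaximalCompactSubgroup H := by
  refine ⟨isCompact_of_mem_verticialSubgroups c hH, fun K hKc hHK => ?_⟩
  by_cases hbot : H = ⊥
  · refine le_antisymm (fun g hg => ?_) hHK
    by_contra hgH
    obtain ⟨-, h2⟩ := verticialDistinct_holds 𝒢 h37 c
    have h0 := h2 v H hH 1 g (by simpa using hgH)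
    subst hbot
    simp at h0
  · obtain ⟨v', H', hH', hKH'⟩ := exists_verticial_ge_of_inf_verticial_ne_bot_of_topCyclic h37 hcyc c K hKc hH
      (by rwa [inf_eq_right.mpr hHK])
    have hHH' : H = H' :=
      eq_of_le_of_mem_verticialSubgroups verticialDistinct_holds h37 c hH hH' (hHK.trans hKH')
    subst hHH'
    exact le_antisymm hKH' hHK

/-- **Thm 3.7 (iv), first sentence, for ANCHORED subgroups** (topologically cyclic edge groups, any `𝔾`, every
chart): a subgroup meeting some verticial subgroup non-trivially is maximal compact iff it is verticial.
[cite: MochizukiSemiAnbd2006, Thm 3.7(iv) p.41] -/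
theorem isMaximalCompactSubgroup_iff_mem_verticialSubgroups_of_anchored_of_topCyclic (h37 : 𝒢.Thm37Hypotheses)
    (hcyc : ∀ e : 𝒢.graph.Edge, ∃ t₀ : 𝒢.Ge e, (Subgroup.zpowers t₀).topologicalClosure = ⊤)
    (c : TemperedPiChart 𝒢) (K : Subgroup c.G)
    {v₀ : 𝒢.graph.Vertex} {H₀ : Subgroup c.G} (hH₀ : H₀ ∈ verticialSubgroups c v₀) (hanch : K ⊓ H₀ ≠ ⊥) :
    IsMaximalCompactSubgroup K ↔ ∃ v : 𝒢.graph.Vertex, K ∈ verticialSubgroups c v :=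
  ⟨fun hK => exists_mem_verticialSubgroups_of_isMaximalCompactSubgroup_of_topCyclic h37 hcyc c K hK hH₀ hanch,
    fun ⟨_, hK⟩ => 𝒢.isMaximalCompactSubgroup_of_mem_verticialSubgroups_of_topCyclic h37 hcyc c hK⟩

/-- **Thm 3.7 (iv), second sentence «⇐» — topologically cyclic edge groups, any `𝔾`, every chart** (unconditional):
a nontrivial edge-like subgroup of a closed edge is the intersection of two distinct maximal compact subgroups
(abc-iut-f-173's `edgeLikeIsInfVerticialAt_holds` + the previous theorem). [cite: MochizukiSemiAnbd2006, Thm 3.7(iv) p.41] -/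
theorem exists_maximalCompact_inf_eq_of_mem_edgeLikeSubgroups_of_topCyclic (h37 : 𝒢.Thm37Hypotheses)
    (hcyc : ∀ e : 𝒢.graph.Edge, ∃ t₀ : 𝒢.Ge e, (Subgroup.zpowers t₀).topologicalClosure = ⊤)
    (c : TemperedPiChart 𝒢) {e : 𝒢.graph.Edge} (he : 𝒢.graph.IsClosedEdge e)
    {L : Subgroup c.G} (hL : L ∈ edgeLikeSubgroups c e) (hLne : L ≠ ⊥) :
    ∃ K₁ K₂ : Subgroup c.G, IsMaximalCompactSubgroup K₁ ∧ IsMaximalCompactSubgroup K₂ ∧ K₁ ≠ K₂ ∧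
      L = K₁ ⊓ K₂ := by
  obtain ⟨v₁, v₂, H₁, H₂, hH₁, hH₂, hne, rfl⟩ := edgeLikeIsInfVerticialAt_holds 𝒢 h37 c e he L hL hLne
  exact ⟨H₁, H₂, 𝒢.isMaximalCompactSubgroup_of_mem_verticialSubgroups_of_topCyclic h37 hcyc c hH₁,
    𝒢.isMaximalCompactSubgroup_of_mem_verticialSubgroups_of_topCyclic h37 hcyc c hH₂, hne, rfl⟩

/-- **Thm 3.7 (iv), second sentence «⇒», for an ANCHORED pair** (topologically cyclic edge groups, any `𝔾`, every
chart): a nontrivial intersection of two distinct maximal compact subgroups, one of which meets some verticial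
subgroup non-trivially, is an edge-like subgroup of a closed edge (abc-iut-w6-d062's argument with abc-iut-f-172's
`compactInTwoVerticial_of_topCyclic`). [cite: MochizukiSemiAnbd2006, Thm 3.7(iv) p.41] -/
theorem exists_mem_edgeLikeSubgroups_of_maximalCompact_inf_of_anchored_of_topCyclic (h37 : 𝒢.Thm37Hypotheses)
    (hcyc : ∀ e : 𝒢.graph.Edge, ∃ t₀ : 𝒢.Ge e, (Subgroup.zpowers t₀).topologicalClosure = ⊤)
    (c : TemperedPiChart 𝒢)
    {K₁ K₂ : Subgroup c.G} (hK₁ : IsMaximalCompactSubgroup K₁) (hK₂ : IsMaximalCompactSubgroup K₂)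
    (hne : K₁ ≠ K₂) (hL : K₁ ⊓ K₂ ≠ ⊥)
    {v₀ : 𝒢.graph.Vertex} {H₀ : Subgroup c.G} (hH₀ : H₀ ∈ verticialSubgroups c v₀) (hanch : K₁ ⊓ H₀ ≠ ⊥) :
    ∃ e : 𝒢.graph.Edge, 𝒢.graph.IsClosedEdge e ∧ K₁ ⊓ K₂ ∈ edgeLikeSubgroups c e := by
  obtain ⟨v₁, hK₁v⟩ :=
    exists_mem_verticialSubgroups_of_isMaximalCompactSubgroup_of_topCyclic h37 hcyc c K₁ hK₁ hH₀ hanch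
  obtain ⟨v₂, hK₂v⟩ :=
    exists_mem_verticialSubgroups_of_isMaximalCompactSubgroup_of_topCyclic h37 hcyc c K₂ hK₂ hK₁v (by rwa [inf_comm])
  haveI := c.t2Space
  have hLc : IsCompact ((K₁ ⊓ K₂ : Subgroup c.G) : Set c.G) := by
    rw [Subgroup.coe_inf]
    exact hK₁.1.inter_right hK₂.1.isClosed
  obtain ⟨honly, e, L', he, hL', hLL'⟩ := 𝒢.compactInTwoVerticial_of_topCyclic h37 hcyc c (K₁ ⊓ K₂)
    hLc hL hK₁v hK₂v hne inf_le_left inf_le_right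
  have hL'ne : L' ≠ ⊥ := fun h => hL (le_bot_iff.mp (h ▸ hLL'))
  obtain ⟨w₁, w₂, H₁, H₂, hH₁, hH₂, hH, rfl⟩ := edgeLikeIsInfVerticialAt_holds 𝒢 h37 c e he L' hL' hL'ne
  have hH₁' := honly w₁ H₁ hH₁ (hLL'.trans inf_le_left)
  have hH₂' := honly w₂ H₂ hH₂ (hLL'.trans inf_le_right)
  refine ⟨e, he, ?_⟩
  rcases hH₁' with rfl | rfl <;> rcases hH₂' with rfl | rfl
  · exact absurd rfl hH
  · exact hL'
  · rw [inf_comm]; exact hL'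
  · exact absurd rfl hH

/-- **Maximal compact subgroups, topologically cyclic edge groups, any `𝔾`, every chart: VERTICIAL, or (ANCHOR-FREE
and COMMUTATIVE)** — the exotic maximal compact subgroups are exactly the commutative anchor-free ones.
[cite: MochizukiSemiAnbd2006, Thm 3.7(iv) p.41] -/
theorem mem_verticialSubgroups_or_anchorFree_and_commutative_of_isMaximalCompactSubgroup_of_topCyclic
    (h37 : 𝒢.Thm37Hypotheses)
    (hcyc : ∀ e : 𝒢.graph.Edge, ∃ t₀ : 𝒢.Ge e, (Subgroup.zpowers t₀).topologicalClosure = ⊤)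
    (c : TemperedPiChart 𝒢) (K : Subgroup c.G) (hK : IsMaximalCompactSubgroup K) :
    (∃ v : 𝒢.graph.Vertex, K ∈ verticialSubgroups c v) ∨
      ((∀ (v : 𝒢.graph.Vertex) (H : Subgroup c.G), H ∈ verticialSubgroups c v → K ⊓ H = ⊥) ∧
        ∀ g₁ ∈ K, ∀ g₂ ∈ K, g₁ * g₂ = g₂ * g₁) := by
  by_cases h : ∃ (v : 𝒢.graph.Vertex) (H : Subgroup c.G), H ∈ verticialSubgroups c v ∧ K ≤ H
  · obtain ⟨v, H, hH, hle⟩ := h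
    exact Or.inl ⟨v, (hK.2 H (isCompact_of_mem_verticialSubgroups c hH) hle) ▸ hH⟩
  · push Not at h
    refine Or.inr ⟨fun v H hH => inf_verticial_eq_bot_of_forall_not_le_of_topCyclic h37 hcyc c K hK.1 h hH,
      commutative_of_forall_not_le_verticial_of_commEdges h37.toProp36Hypotheses (𝒢.commEdges_of_topCyclic hcyc)
        c K hK.1 h⟩

end ProfiniteSemiGraph

end Literature.AnabelianGeometry.SemiGraphs
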